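import Literature.NumberTheory.ComplexMultiplication.SharedImaginaryQuadraticFamilies
import Literature.AlgebraicGeometry.Pohlmann1968.SeparatingCMFamilies
import Literature.AlgebraicGeometry.ComplexMultiplication.RealIntersectionCMFieldsHodge
import HarnessLib

/-!
# Two simple CM abelian varieties whose CM fields share an imaginary quadratic subfield ALWAYS carry an exceptional
# Hodge class on some `A₀^a × A₁^b`; with one Galois CM field of degree `≡ 2 (mod 4)` the parity of `[L₀ ∩ L₁ : ℚ]` decides

COR-CM (cell `pub-hodgecm2`, binder seat `b23` gen 28), count-neutral; NEW as stated, hence under `Summits/`.  The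
geometric face of `Literature.NumberTheory.ComplexMultiplication.SharedImaginaryQuadraticFamilies` (this seat), which
removed every degree/signature hypothesis from the shared-quadratic obstruction: two CM fields `K_{i₀} ⊇ k ⊆ K_{i₁}`
through a common imaginary quadratic field `k` have NO nondegenerate family of CM types.  It supersedes
`Summits/…/SharedImaginaryQuadraticExotic` (non-zero defects) and `…/TwiceOddDegreeCMFieldPairsHodge` (both degrees
`≡ 2 (mod 4)`).  For realisations `(A_i, ι_i, θ_i)` of CM types `Φ_i` on `H¹`:

* **`exists_exceptional_prod_of_shared_imaginary_quadratic`** — a SEPARATING family (simple, pairwise non-isogenous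
  factors) two of whose CM fields contain the imaginary quadratic field `k`: some product `⨁_{j<N} A_{π j}` carries a
  rational `(m,m)`-class OUTSIDE `Dᵐ ⊗ ℂ`, WHATEVER the types (a Weil class of `k` on `A₀^a × A₁^b`, or — balanced
  signature — already on a power of one factor); `not_forall_prod_hodgeClassSpan_eq_of_shared_imaginary_quadratic`;
  **`exists_exceptional_prod_of_isSimple_of_shared_imaginary_quadratic`** — the same for two SIMPLE, NON-ISOGENOUS CM
  abelian varieties with `k ↪ K_{i₀}`, `k ↪ K_{i₁}`;
* with `K_{i₁}` Galois of degree `2m₁`, `m₁` ODD, and `K_{i₀}` ANY Galois CM field (`d = [L₀ ∩ L₁ : ℚ]`):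
  **`isNondegenerateFamily_iff_of_twice_odd'`** (`IsNondegenerateFamily Φ ⟺ d odd ∧ every Φ_i nondegenerate`),
  **`forall_prod_hodgeClassSpan_eq_iff_of_twice_odd'`** (separating: `B• = D•` on all products ⟺ the same),
  **`exists_exceptional_prod_iff_of_twice_odd'`** (separating: an exceptional class on some product ⟺ `d` even ∨ a
  member degenerate), `hodgeConjectureFor_prod_or_exists_exceptional_of_isSimple_of_twice_odd'` (packaged dichotomy).

Examples: `E_k × A` for ANY simple CM `A` with `k ⊆ End⁰(A)` (`A ≠ E_k`); two simple CM threefolds with cyclic sextic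
fields through the same `k`; `ℚ(ζ_7)`-threefold × `ℚ(√−7, √2, √5)`-type CM fourfold (shared `ℚ(√−7)`): exceptional
classes forced.  Theorems only, no definition, no `sorry`; the classes are NOT claimed algebraic or non-algebraic.

## References

* [Gordon1999HodgeAVSurvey] B. B. Gordon, *A survey of the Hodge conjecture for abelian varieties*, §3 Theorem (proof),
  7.4–7.7, 7.6.1, 9.4.3, 10.10.
* [Deligne1982HodgeCycles] P. Deligne, *Hodge cycles on abelian varieties*, LNM 900 (1982), §4 (Weil classes).
* [Rotman1995] J. J. Rotman, *An Introduction to the Theory of Groups*, 4th ed., GTM 148, Thm. 7.41 (Schur–Zassenhaus).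

Provenance: Literature home (namespace `Literature.AlgebraicGeometry.ComplexMultiplication.SharedImaginaryQuadraticCMFieldsHodge`) of the Summits-side `CorCM/SharedImaginaryQuadraticCMFieldsHodge` (cell `pub-hodgecm2`, COR-CM; all its imports are `Literature/`, Mathlib and the already re-homed `RealIntersectionCMFieldsHodge`), which `Literature/` may not import; theorems only, no named fact, no definition. Nothing here bears on `HC_CM`. Lane `lit-hodgefound` (Layer A3: CM types, their Kubota ranks and Galois combinatorics), seat p20.
-/

noncomputable section

open _root_.CategoryTheory _root_.CategoryTheory.Limits NumberField IntermediateField Module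

namespace Literature.AlgebraicGeometry.ComplexMultiplication.SharedImaginaryQuadraticCMFieldsHodge

open Literature.AlgebraicGeometry.ComplexMultiplication.RealIntersectionCMFieldsHodge

open Literature.NumberTheory.ComplexMultiplication
open Literature.AlgebraicGeometry.Motives (AbelianVariety CMType)
open Literature.AlgebraicGeometry.HodgeTheory
open Literature.AlgebraicGeometry.ComplexMultiplication (IsCMTypeRealisation)
open Literature.AlgebraicGeometry.VanGeemen1994 (hodgeClassSpan)
open Literature.AlgebraicGeometry.Pohlmann1968
open Literature.Barriers.HodgeConjecture (divisorClassesSpan)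

variable {I : Type} {K : I → Type} [∀ i, Field (K i)] [∀ i, NumberField (K i)] [∀ i, IsCMField (K i)] [Fintype I]
  [Nonempty I] {Φ : ∀ i, CMType (K i)}
variable {A : I → AbelianVariety ℂ} {ι : ∀ i, 𝓞 (K i) →+* End (A i)}
  {θ : ∀ i, K i →+* Module.End ℂ (complexBetti (A i).X 1)}

/-! ### A shared imaginary quadratic field forces an exceptional Hodge class, whatever the types -/

section Shared

variable {k : Type} [Field k] [NumberField k] [IsTotallyComplex k]

/-- **A shared imaginary quadratic field forces an exceptional Hodge class — whatever the types.**  Let `(K_i; Φ_i)` be a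
separating family (simple, pairwise non-isogenous realisations `A_i`) and `k` an imaginary quadratic field with
embeddings `j₀ : k → K_{i₀}`, `j₁ : k → K_{i₁}`, `i₀ ≠ i₁`.  Then some product `⨁_{j<N} A_{π j}` carries a rational
`(m,m)`-class outside `Dᵐ ⊗ ℂ`: the family is degenerate (`not_isNondegenerateFamily_of_shared_imaginary_quadratic` —
no signature hypothesis) and degenerate separating families have exceptional classes (Hazama–Murty).
[cite: Gordon1999HodgeAVSurvey, 7.5, 7.6.1 and 9.4.3] [cite: Deligne1982HodgeCycles, §4] -/
theorem exists_exceptional_prod_of_shared_imaginary_quadratic (hsep : CMAlgebra.IsSeparatingFamily Φ)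
    (hk : finrank ℚ k = 2) {i₀ i₁ : I} (h01 : i₀ ≠ i₁) (j₀ : k →+* K i₀) (j₁ : k →+* K i₁)
    (hA : ∀ i, IsCMTypeRealisation (Φ i) (A i) (ι i) (θ i)) :
    ∃ (N : ℕ) (π : Fin N → I) (m : ℕ) (c : complexBetti (⨁ fun j : Fin N => A (π j)).X (2 * m)),
      IsRationalClass c ∧
      IsOfHodgeType (⨁ fun j : Fin N => A (π j)).dim (⨁ fun j : Fin N => A (π j)).X (2 * m) m m c ∧
      c ∉ divisorClassesSpan (⨁ fun j : Fin N => A (π j)).X (⨁ fun j : Fin N => A (π j)).dim m :=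
  CMAlgebra.exists_exceptional_prod_of_not_isNondegenerateFamily hsep
    (not_isNondegenerateFamily_of_shared_imaginary_quadratic hk h01 j₀ j₁ Φ) hA

/-- **`B• = D•` fails on some product** of a separating family two of whose CM fields share an imaginary quadratic field.
[cite: Gordon1999HodgeAVSurvey, 7.5 and 7.6.1] -/
theorem not_forall_prod_hodgeClassSpan_eq_of_shared_imaginary_quadratic (hsep : CMAlgebra.IsSeparatingFamily Φ)
    (hk : finrank ℚ k = 2) {i₀ i₁ : I} (h01 : i₀ ≠ i₁) (j₀ : k →+* K i₀) (j₁ : k →+* K i₁)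
    (hA : ∀ i, IsCMTypeRealisation (Φ i) (A i) (ι i) (θ i)) :
    ¬ ∀ (N : ℕ) (π : Fin N → I) (m : ℕ),
      hodgeClassSpan (⨁ fun j : Fin N => A (π j)).dim (⨁ fun j : Fin N => A (π j)).X m =
        divisorClassesSpan (⨁ fun j : Fin N => A (π j)).X (⨁ fun j : Fin N => A (π j)).dim m := fun h =>
  not_isNondegenerateFamily_of_shared_imaginary_quadratic hk h01 j₀ j₁ Φ
    ((CMAlgebra.isNondegenerateFamily_iff_forall_prod_hodgeClassSpan_eq hsep hA).2 h)

/-- **Two SIMPLE, NON-ISOGENOUS CM abelian varieties whose CM fields share an imaginary quadratic subfield carry an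
exceptional Hodge class on some `A₀^a × A₁^b`** (some `⨁_{j<N} A_{π j}`) — for EVERY choice of CM types, in every dimension:
`E_k × A` for any simple CM `A ≁ E_k` with `k ⊆ End⁰(A)`, two simple CM threefolds with cyclic sextic fields through the
same `k`, …  (The exceptional classes are not claimed algebraic or non-algebraic.) [cite: Gordon1999HodgeAVSurvey, 7.4–7.6.1 and 9.4.3]
[cite: Deligne1982HodgeCycles, §4] -/
theorem exists_exceptional_prod_of_isSimple_of_shared_imaginary_quadratic (hk : finrank ℚ k = 2) {i₀ i₁ : I}
    (h01 : i₀ ≠ i₁) (j₀ : k →+* K i₀) (j₁ : k →+* K i₁) (hA : ∀ i, IsCMTypeRealisation (Φ i) (A i) (ι i) (θ i))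
    (hs : ∀ i, (A i).IsSimple) (hniso : ∀ i j, i ≠ j → ¬ AbelianVariety.IsIsogenous (A i) (A j)) :
    ∃ (N : ℕ) (π : Fin N → I) (m : ℕ) (c : complexBetti (⨁ fun j : Fin N => A (π j)).X (2 * m)),
      IsRationalClass c ∧
      IsOfHodgeType (⨁ fun j : Fin N => A (π j)).dim (⨁ fun j : Fin N => A (π j)).X (2 * m) m m c ∧
      c ∉ divisorClassesSpan (⨁ fun j : Fin N => A (π j)).X (⨁ fun j : Fin N => A (π j)).dim m :=
  exists_exceptional_prod_of_shared_imaginary_quadratic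
    (CMAlgebra.isSeparatingFamily_of_isSimple_of_pairwise_not_isIsogenous hA hs hniso) hk h01 j₀ j₁ hA

end Shared

/-! ### One Galois CM field of degree `≡ 2 (mod 4)`: the parity of `[L₀ ∩ L₁ : ℚ]` decides -/

section Parity

/-- **The deciding invariant, one field of degree `≡ 2 (mod 4)`.**  `K_{i₁}` Galois CM of degree `2m₁`, `m₁` odd;
`K_{i₀}` ANY Galois CM field; ANY types: the family is nondegenerate iff `[L₀ ∩ L₁ : ℚ]` is ODD and both members are
nondegenerate. [cite: Gordon1999HodgeAVSurvey, §3 Theorem, 7.5–7.7, 7.6.1 and 9.4.3] [cite: Rotman1995, Thm. 7.41] -/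
theorem isNondegenerateFamily_iff_of_twice_odd' {m₁ : ℕ} (hm₁ : Odd m₁) {i₀ i₁ : I} (h01 : i₀ ≠ i₁)
    (hI : ∀ j, j = i₀ ∨ j = i₁) [IsGalois ℚ (K i₀)] [IsGalois ℚ (K i₁)] (h₁ : finrank ℚ (K i₁) = 2 * m₁) :
    CMAlgebra.IsNondegenerateFamily Φ ↔
      Odd (finrank ℚ ↥(normalClosure ℚ (K i₀) ℂ ⊓ normalClosure ℚ (K i₁) ℂ)) ∧ ∀ i, IsNondegenerate (Φ i) := by
  refine ⟨fun hnd => ⟨?_, fun i => hnd.isNondegenerate i⟩, fun h => ?_⟩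
  · rcases Nat.even_or_odd (finrank ℚ ↥(normalClosure ℚ (K i₀) ℂ ⊓ normalClosure ℚ (K i₁) ℂ)) with hev | hodd
    · exact absurd hnd (not_isNondegenerateFamily_of_even_finrank_inf hm₁ h01 h₁ hev Φ)
    · exact hodd
  · exact (isNondegenerateFamily_iff_of_partialConj (forall_exists_partialConj_pair_of_odd_finrank h01 hI h.1) Φ).2 h.2

/-- **`[L₀ ∩ L₁ : ℚ]` even ⟹ an exceptional Hodge class is forced, whatever the types** (separating realisations;
`K_{i₁}` Galois of degree `2m₁`, `m₁` odd, `K_{i₀}` any Galois CM field). [cite: Gordon1999HodgeAVSurvey, 7.5, 7.6.1 and 9.4.3]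
[cite: Deligne1982HodgeCycles, §4] [cite: Rotman1995, Thm. 7.41] -/
theorem exists_exceptional_prod_of_even_finrank_inf {m₁ : ℕ} (hm₁ : Odd m₁) {i₀ i₁ : I} (h01 : i₀ ≠ i₁)
    [IsGalois ℚ (K i₀)] [IsGalois ℚ (K i₁)] (h₁ : finrank ℚ (K i₁) = 2 * m₁) (hsep : CMAlgebra.IsSeparatingFamily Φ)
    (hev : Even (finrank ℚ ↥(normalClosure ℚ (K i₀) ℂ ⊓ normalClosure ℚ (K i₁) ℂ)))
    (hA : ∀ i, IsCMTypeRealisation (Φ i) (A i) (ι i) (θ i)) :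
    ∃ (N : ℕ) (π : Fin N → I) (m : ℕ) (c : complexBetti (⨁ fun j : Fin N => A (π j)).X (2 * m)),
      IsRationalClass c ∧
      IsOfHodgeType (⨁ fun j : Fin N => A (π j)).dim (⨁ fun j : Fin N => A (π j)).X (2 * m) m m c ∧
      c ∉ divisorClassesSpan (⨁ fun j : Fin N => A (π j)).X (⨁ fun j : Fin N => A (π j)).dim m :=
  CMAlgebra.exists_exceptional_prod_of_not_isNondegenerateFamily hsep
    (not_isNondegenerateFamily_of_even_finrank_inf hm₁ h01 h₁ hev Φ) hA

/-- **`B• = D•` on every `A₀^a × A₁^b` iff `[L₀ ∩ L₁ : ℚ]` is odd and both types are nondegenerate** (separating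
realisations; `K_{i₁}` Galois of degree `2m₁`, `m₁` odd, `K_{i₀}` any Galois CM field).
[cite: Gordon1999HodgeAVSurvey, §3 Theorem, 7.5–7.7, 7.6.1 and 9.4.3] [cite: Rotman1995, Thm. 7.41] -/
theorem forall_prod_hodgeClassSpan_eq_iff_of_twice_odd' {m₁ : ℕ} (hm₁ : Odd m₁) {i₀ i₁ : I} (h01 : i₀ ≠ i₁)
    (hI : ∀ j, j = i₀ ∨ j = i₁) [IsGalois ℚ (K i₀)] [IsGalois ℚ (K i₁)] (h₁ : finrank ℚ (K i₁) = 2 * m₁)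
    (hsep : CMAlgebra.IsSeparatingFamily Φ) (hA : ∀ i, IsCMTypeRealisation (Φ i) (A i) (ι i) (θ i)) :
    (∀ (N : ℕ) (π : Fin N → I) (m : ℕ),
        hodgeClassSpan (⨁ fun j : Fin N => A (π j)).dim (⨁ fun j : Fin N => A (π j)).X m =
          divisorClassesSpan (⨁ fun j : Fin N => A (π j)).X (⨁ fun j : Fin N => A (π j)).dim m) ↔
      Odd (finrank ℚ ↥(normalClosure ℚ (K i₀) ℂ ⊓ normalClosure ℚ (K i₁) ℂ)) ∧ ∀ i, IsNondegenerate (Φ i) :=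
  (CMAlgebra.isNondegenerateFamily_iff_forall_prod_hodgeClassSpan_eq hsep hA).symm.trans
    (isNondegenerateFamily_iff_of_twice_odd' hm₁ h01 hI h₁)

/-- **An exceptional Hodge class on some `A₀^a × A₁^b` iff `[L₀ ∩ L₁ : ℚ]` is even or a type is degenerate** (separating
realisations; `K_{i₁}` Galois of degree `2m₁`, `m₁` odd, `K_{i₀}` any Galois CM field).
[cite: Gordon1999HodgeAVSurvey, 7.5–7.7, 7.6.1 and 9.4.3] [cite: Deligne1982HodgeCycles, §4] [cite: Rotman1995, Thm. 7.41] -/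
theorem exists_exceptional_prod_iff_of_twice_odd' {m₁ : ℕ} (hm₁ : Odd m₁) {i₀ i₁ : I} (h01 : i₀ ≠ i₁)
    (hI : ∀ j, j = i₀ ∨ j = i₁) [IsGalois ℚ (K i₀)] [IsGalois ℚ (K i₁)] (h₁ : finrank ℚ (K i₁) = 2 * m₁)
    (hsep : CMAlgebra.IsSeparatingFamily Φ) (hA : ∀ i, IsCMTypeRealisation (Φ i) (A i) (ι i) (θ i)) :
    (∃ (N : ℕ) (π : Fin N → I) (m : ℕ) (c : complexBetti (⨁ fun j : Fin N => A (π j)).X (2 * m)),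
        IsRationalClass c ∧
        IsOfHodgeType (⨁ fun j : Fin N => A (π j)).dim (⨁ fun j : Fin N => A (π j)).X (2 * m) m m c ∧
        c ∉ divisorClassesSpan (⨁ fun j : Fin N => A (π j)).X (⨁ fun j : Fin N => A (π j)).dim m) ↔
      Even (finrank ℚ ↥(normalClosure ℚ (K i₀) ℂ ⊓ normalClosure ℚ (K i₁) ℂ)) ∨ ∃ i, ¬ IsNondegenerate (Φ i) := by
  constructor
  · rintro ⟨N, π, m, c, hcQ, hcH, hcD⟩
    by_contra h
    push Not at h
    have hnd : CMAlgebra.IsNondegenerateFamily Φ :=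
      (isNondegenerateFamily_iff_of_twice_odd' hm₁ h01 hI h₁).2 ⟨Nat.not_even_iff_odd.1 h.1, h.2⟩
    exact hnd.not_exists_exceptional_prod hA π m ⟨c, hcQ, hcH, hcD⟩
  · intro h
    refine CMAlgebra.exists_exceptional_prod_of_not_isNondegenerateFamily hsep (fun hnd => ?_) hA
    have h' := (isNondegenerateFamily_iff_of_twice_odd' hm₁ h01 hI h₁).1 hnd
    rcases h with hev | ⟨i, hi⟩
    · exact (Nat.not_even_iff_odd.2 h'.1) hev
    · exact hi (h'.2 i)

/-- **The packaged dichotomy** for two simple, non-isogenous CM abelian varieties with nondegenerate types, `K_{i₁}` Galois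
CM of degree `2m₁`, `m₁` odd, `K_{i₀}` any Galois CM field: EITHER `[L₀ ∩ L₁ : ℚ]` is odd and the Hodge conjecture holds
for every `⨁_{j<N} A_{π j}` (every `A₀^a × A₁^b`) with `B• = D•` there, OR it is even and some such product carries a
rational `(m,m)`-class outside `Dᵐ ⊗ ℂ`. [cite: Gordon1999HodgeAVSurvey, §3 Theorem, 7.4–7.7, 9.4.3 and 10.10]
[cite: Rotman1995, Thm. 7.41] -/
theorem hodgeConjectureFor_prod_or_exists_exceptional_of_isSimple_of_twice_odd' {m₁ : ℕ} (hm₁ : Odd m₁)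
    {i₀ i₁ : I} (h01 : i₀ ≠ i₁) (hI : ∀ j, j = i₀ ∨ j = i₁) [IsGalois ℚ (K i₀)] [IsGalois ℚ (K i₁)]
    (h₁ : finrank ℚ (K i₁) = 2 * m₁) (hΦ : ∀ i, IsNondegenerate (Φ i))
    (hA : ∀ i, IsCMTypeRealisation (Φ i) (A i) (ι i) (θ i)) (hs : ∀ i, (A i).IsSimple)
    (hniso : ∀ i j, i ≠ j → ¬ AbelianVariety.IsIsogenous (A i) (A j)) :
    (Odd (finrank ℚ ↥(normalClosure ℚ (K i₀) ℂ ⊓ normalClosure ℚ (K i₁) ℂ)) ∧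
        ∀ (N : ℕ) (π : Fin N → I),
          HodgeConjectureFor (⨁ fun j : Fin N => A (π j)).dim (⨁ fun j : Fin N => A (π j)).X ∧
            ∀ m : ℕ, hodgeClassSpan (⨁ fun j : Fin N => A (π j)).dim (⨁ fun j : Fin N => A (π j)).X m =
              divisorClassesSpan (⨁ fun j : Fin N => A (π j)).X (⨁ fun j : Fin N => A (π j)).dim m) ∨
      (Even (finrank ℚ ↥(normalClosure ℚ (K i₀) ℂ ⊓ normalClosure ℚ (K i₁) ℂ)) ∧
        ∃ (N : ℕ) (π : Fin N → I) (m : ℕ) (c : complexBetti (⨁ fun j : Fin N => A (π j)).X (2 * m)),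
          IsRationalClass c ∧
          IsOfHodgeType (⨁ fun j : Fin N => A (π j)).dim (⨁ fun j : Fin N => A (π j)).X (2 * m) m m c ∧
          c ∉ divisorClassesSpan (⨁ fun j : Fin N => A (π j)).X (⨁ fun j : Fin N => A (π j)).dim m) := by
  have hsep : CMAlgebra.IsSeparatingFamily Φ :=
    CMAlgebra.isSeparatingFamily_of_isSimple_of_pairwise_not_isIsogenous hA hs hniso
  rcases Nat.even_or_odd (finrank ℚ ↥(normalClosure ℚ (K i₀) ℂ ⊓ normalClosure ℚ (K i₁) ℂ)) with hev | hodd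
  · exact Or.inr ⟨hev, exists_exceptional_prod_of_even_finrank_inf hm₁ h01 h₁ hsep hev hA⟩
  · exact Or.inl ⟨hodd, fun N π =>
      ⟨hodgeConjectureFor_prod_of_partialConj (forall_exists_partialConj_pair_of_odd_finrank h01 hI hodd) hΦ hA π,
        fun m => hodgeClassSpan_prod_eq_divisorClassesSpan_of_partialConj
          (forall_exists_partialConj_pair_of_odd_finrank h01 hI hodd) hΦ hA π m⟩⟩

end Parity

end Literature.AlgebraicGeometry.ComplexMultiplication.SharedImaginaryQuadraticCMFieldsHodge

end
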